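import Summits.Schanuel.Schanuel.Theorems.RootDecomp1BTwoStorey01

/-!
# RootDecomp1BTwoStorey — lens 4, generation 43 «TWO-PARAMETER RADICAL DESCENT: STOREY THREE AT (1, ρ, σ)» (lane B-R26 (e); CLAIM L2197, ACK/CHECKLIST B-g43 L2199, NODE L2206 / REQUEST L2207, writer re-check L2211, critic VERDICT L2210: CLEARED — ONE CELL (lane (e) «m = 3 storeys»; engine VARIANT-REACH+ of g30, class NEW-LOCAL, territory NEW); RULE B-R29; lens-4 tally THEOREM ×7 + CELL ×4) — continuation (RootDecomp1BTwoStorey02): §D-data + §C part 1 (classes UltraLiouville₂ / JU)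

(lens-4 g43 HOME kernel K = HOME/decomp-schanuel-lens-4/g43/TwoStorey.lean 24f29895…, 1683 l; VERDICT L2210 PORT GO; port by census-1 gen 19 as `RootDecomp1BTwoStorey01`–`06`: 01 = §A formal algebra + §B sizes; 02 = §D-data + §C part 1 (classes `UltraLiouville₂` / `JU`); 03 = §C part 2 (collision, two-dimensional non-vanishing, typed obstruction); 04 = §C part 3 (Baire density, controls); 05 = §D kernel `algebraicIndependent_radical₂` (pending cap edition); 06 = §E storey-three cells.
PORT EDITS: class defs' docstrings tagged «[class] definition …»; private port copies of length lemmas kept private (per-part private copies where a later part uses them); statements and proofs verbatim. `--supports stmt-Schanuel-24622`; no census credit carried; rung 0 — nothing here proves Schanuel.)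
-/

noncomputable section

open Complex

namespace Summit.Schanuel.Schanuel.Theorems.RootDecomp1BTwoStorey

open Summit.Schanuel.Schanuel.Theorems.RootDecomp1BRadicalDescent (resFin resFin_val powSubst powSubst_X_self
  powSubst_eq_zero_iff QDiv qdiv_powSubst residue_lemma)

section PortCopies2
open MvPolynomial
open Summit.Schanuel.Schanuel.Theorems.RootDecomp1KHyper (mvlen mvlen_nonneg mvlen_eq_sum_of_support_subset)
variable {n : ℕ}

/-- The length of a monomial `c · x^m` is at most `|c|`. -/
private theorem mvlen_monomial_le (m : Fin n →₀ ℕ) (c : ℤ) : mvlen (monomial m c) ≤ |c| := by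
  classical
  rw [mvlen_eq_sum_of_support_subset _ support_monomial_subset, Finset.sum_singleton, coeff_monomial,
    if_pos rfl]

/-- The length of the zero polynomial is `0`. -/
private theorem mvlen_zero : mvlen (0 : MvPolynomial (Fin n) ℤ) = 0 := by simp [mvlen]

/-- Subadditivity of the length. -/
private theorem mvlen_add_le (P Q : MvPolynomial (Fin n) ℤ) : mvlen (P + Q) ≤ mvlen P + mvlen Q := by
  classical
  rw [mvlen_eq_sum_of_support_subset _ support_add,
    mvlen_eq_sum_of_support_subset P (Finset.subset_union_left (s₂ := Q.support)),
    mvlen_eq_sum_of_support_subset Q (Finset.subset_union_right (s₁ := P.support)),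
    ← Finset.sum_add_distrib]
  exact Finset.sum_le_sum fun m _ => by rw [coeff_add]; exact abs_add_le _ _

/-- The length of a finite sum is at most the sum of the lengths. -/
private theorem mvlen_sum_le {ι : Type*} (s : Finset ι) (f : ι → MvPolynomial (Fin n) ℤ) :
    mvlen (∑ i ∈ s, f i) ≤ ∑ i ∈ s, mvlen (f i) := by
  classical
  induction s using Finset.induction_on with
  | empty => simp [mvlen_zero]
  | insert a s ha ih =>
    rw [Finset.sum_insert ha, Finset.sum_insert ha]
    exact (mvlen_add_le _ _).trans (by linarith)

end PortCopies2

/-! ## §D (data)  THE SPECIALISED COEFFICIENTS `C_k`, THE RELATION FUNCTION `F` ON `ℝ²`, THE EIGEN-IDENTITY -/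

section KernelData
open MvPolynomial
open Summit.Schanuel.Schanuel.Theorems.RootDecomp1KHyper (mvlen mvlen_nonneg)
variable {n : ℕ}

/-- The `X`-part of an exponent vector `s` of `P ∈ ℤ[U₁, U₂, Y₁, Y₂, X_1, …, X_n]` (drops the first four slots). -/
def sX4 (s : Fin (n + 4) →₀ ℕ) : Fin n →₀ ℕ := Finsupp.tail (Finsupp.tail (Finsupp.tail (Finsupp.tail s)))

/-- `sX4 s j = s (j+4)`. -/
theorem sX4_apply (s : Fin (n + 4) →₀ ℕ) (j : Fin n) : sX4 s j = s j.succ.succ.succ.succ := by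
  simp [sX4, Finsupp.tail_apply]

/-- An exponent vector is determined by its four head slots and its `X`-part. -/
theorem eq_of_parts4 {s s' : Fin (n + 4) →₀ ℕ} (h0 : s 0 = s' 0) (h1 : s 1 = s' 1) (h2 : s 2 = s' 2)
    (h3 : s 3 = s' 3) (hX : sX4 s = sX4 s') : s = s' := by
  ext j
  refine Fin.cases ?_ (fun j => ?_) j
  · exact h0
  refine Fin.cases ?_ (fun j => ?_) j
  · exact h1
  refine Fin.cases ?_ (fun j => ?_) j
  · exact h2
  refine Fin.cases ?_ (fun j => ?_) j
  · exact h3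
  · have := congrArg (fun f : Fin n →₀ ℕ => f j) hX
    simpa [sX4_apply] using this

variable (P : MvPolynomial (Fin (n + 4)) ℤ) (a b q J : ℕ)

/-- `C_k := q^J · [U₁^{k₁} U₂^{k₂}] P(U₁, U₂, a/q, b/q, X) ∈ ℤ[X]` — the specialised `(U₁^{k₁} U₂^{k₂})`-coefficient
(`J ≥ s₂ + s₃` for every monomial clears the denominators). -/
def Cf₂ (k : ℕ × ℕ) : MvPolynomial (Fin n) ℤ :=
  ∑ s ∈ P.support with ((s 0, s 1) : ℕ × ℕ) = k,
    monomial (sX4 s) (P.coeff s * (a : ℤ) ^ (s 2) * (b : ℤ) ^ (s 3) * (q : ℤ) ^ (J - s 2 - s 3))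

/-- The specialised coefficients `C_k` have total degree `≤ deg P`. -/
theorem totalDegree_Cf₂_le (k : ℕ × ℕ) : (Cf₂ P a b q J k).totalDegree ≤ P.totalDegree := by
  unfold Cf₂
  refine totalDegree_finsetSum_le fun s hs => ?_
  refine (totalDegree_monomial_le _ _).trans ?_
  have hs' : s ∈ P.support := (Finset.mem_filter.1 hs).1
  refine le_trans ?_ (le_totalDegree hs')
  rw [Finsupp.sum_fintype _ _ (fun _ => rfl), Finsupp.sum_fintype _ _ (fun _ => rfl),
    Fin.sum_univ_succ, Fin.sum_univ_succ, Fin.sum_univ_succ, Fin.sum_univ_succ]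
  simp only [sX4_apply, id]
  omega

/-- Length bound `mvlen C_k ≤ mvlen P · (a + b + q)^J` (when every monomial of `P` has `s₂ + s₃ ≤ J`). -/
theorem mvlen_Cf₂_le (hJ : ∀ s ∈ P.support, s 2 + s 3 ≤ J) (k : ℕ × ℕ) :
    mvlen (Cf₂ P a b q J k) ≤ mvlen P * ((a : ℤ) + b + q) ^ J := by
  classical
  unfold Cf₂
  have ha0 : (0 : ℤ) ≤ a := Nat.cast_nonneg _
  have hb0 : (0 : ℤ) ≤ b := Nat.cast_nonneg _
  have hq0 : (0 : ℤ) ≤ q := Nat.cast_nonneg _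
  calc mvlen (∑ s ∈ P.support with ((s 0, s 1) : ℕ × ℕ) = k,
        monomial (sX4 s) (P.coeff s * (a : ℤ) ^ (s 2) * (b : ℤ) ^ (s 3) * (q : ℤ) ^ (J - s 2 - s 3)))
      ≤ ∑ s ∈ P.support with ((s 0, s 1) : ℕ × ℕ) = k,
        mvlen (monomial (sX4 s) (P.coeff s * (a : ℤ) ^ (s 2) * (b : ℤ) ^ (s 3) * (q : ℤ) ^ (J - s 2 - s 3))) :=
        mvlen_sum_le _ _
    _ ≤ ∑ s ∈ P.support with ((s 0, s 1) : ℕ × ℕ) = k, |P.coeff s| * ((a : ℤ) + b + q) ^ J :=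
        Finset.sum_le_sum fun s hs => by
          refine (mvlen_monomial_le _ _).trans ?_
          rw [abs_mul, abs_mul, abs_mul, abs_pow, abs_pow, abs_pow, abs_of_nonneg ha0, abs_of_nonneg hb0,
            abs_of_nonneg hq0, mul_assoc, mul_assoc]
          refine mul_le_mul_of_nonneg_left ?_ (abs_nonneg _)
          have h1 := hJ s (Finset.mem_filter.1 hs).1
          calc (a : ℤ) ^ (s 2) * ((b : ℤ) ^ (s 3) * (q : ℤ) ^ (J - s 2 - s 3))
              ≤ ((a : ℤ) + b + q) ^ (s 2) * (((a : ℤ) + b + q) ^ (s 3) * ((a : ℤ) + b + q) ^ (J - s 2 - s 3)) :=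
                mul_le_mul (pow_le_pow_left₀ ha0 (by linarith) _)
                  (mul_le_mul (pow_le_pow_left₀ hb0 (by linarith) _) (pow_le_pow_left₀ hq0 (by linarith) _)
                    (by positivity) (by positivity)) (by positivity) (by positivity)
            _ = ((a : ℤ) + b + q) ^ J := by
                rw [← pow_add, ← pow_add]; congr 1; omega
    _ ≤ ∑ s ∈ P.support, |P.coeff s| * ((a : ℤ) + b + q) ^ J :=
        Finset.sum_le_sum_of_subset_of_nonneg (Finset.filter_subset _ _) (fun _ _ _ => by positivity)
    _ = mvlen P * ((a : ℤ) + b + q) ^ J := by rw [← Finset.sum_mul]; rfl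

/-- Evaluation of `C_k` at `θ`, expanded over the monomials of `P` with `(U₁,U₂)`-exponent `k`. -/
theorem aeval_Cf₂ (θ : Fin n → ℂ) (k : ℕ × ℕ) :
    aeval θ (Cf₂ P a b q J k) = ∑ s ∈ P.support with ((s 0, s 1) : ℕ × ℕ) = k,
      (((P.coeff s * (a : ℤ) ^ (s 2) * (b : ℤ) ^ (s 3) * (q : ℤ) ^ (J - s 2 - s 3) : ℤ)) : ℂ) *
        ∏ j, θ j ^ (s j.succ.succ.succ.succ) := by
  unfold Cf₂
  rw [map_sum]
  refine Finset.sum_congr rfl fun s _ => ?_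
  rw [aeval_monomial, algebraMap_int_eq, eq_intCast, Finsupp.prod_fintype _ _ (fun _ => by simp)]
  simp only [sX4_apply]

/-- `F(x₁, x₂) := P(e^{x₁ y₀}, e^{x₂ y₀}, x₁, x₂, θ)`, expanded monomially: a `C¹` map `ℝ × ℝ → ℂ`. -/
def Frel₂ (θ : Fin n → ℂ) (y₀ : ℂ) (x : ℝ × ℝ) : ℂ :=
  ∑ s ∈ P.support, ((P.coeff s : ℤ) : ℂ) *
    (cexp ((x.1 : ℂ) * y₀) ^ (s 0) * (cexp ((x.2 : ℂ) * y₀) ^ (s 1) *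
      ((x.1 : ℂ) ^ (s 2) * ((x.2 : ℂ) ^ (s 3) * ∏ j, θ j ^ (s j.succ.succ.succ.succ)))))

/-- `F(x₁, x₂) = P(e^{x₁ y₀}, e^{x₂ y₀}, x₁, x₂, θ)` as an `MvPolynomial.aeval`. -/
theorem Frel₂_eq_aeval (θ : Fin n → ℂ) (y₀ : ℂ) (x : ℝ × ℝ) :
    Frel₂ P θ y₀ x =
      aeval (Fin.cons (cexp ((x.1 : ℂ) * y₀)) (Fin.cons (cexp ((x.2 : ℂ) * y₀))
        (Fin.cons (x.1 : ℂ) (Fin.cons (x.2 : ℂ) θ))) : Fin (n + 4) → ℂ) P := by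
  unfold Frel₂
  rw [MvPolynomial.aeval_def, MvPolynomial.eval₂_eq']
  refine Finset.sum_congr rfl fun s _ => ?_
  rw [Fin.prod_univ_succ, Fin.prod_univ_succ, Fin.prod_univ_succ, Fin.prod_univ_succ]
  simp only [algebraMap_int_eq, eq_intCast, Fin.cons_zero, Fin.cons_succ]
  rfl

/-- `F` is `C¹` on `ℝ²`. -/
theorem contDiff_Frel₂ (θ : Fin n → ℂ) (y₀ : ℂ) : ContDiff ℝ 1 (Frel₂ P θ y₀) := by
  have hx1 : ContDiff ℝ 1 (fun x : ℝ × ℝ => (x.1 : ℂ)) := Complex.ofRealCLM.contDiff.comp contDiff_fst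
  have hx2 : ContDiff ℝ 1 (fun x : ℝ × ℝ => (x.2 : ℂ)) := Complex.ofRealCLM.contDiff.comp contDiff_snd
  show ContDiff ℝ 1 (fun x => Frel₂ P θ y₀ x)
  unfold Frel₂
  refine ContDiff.sum fun s _ => ?_
  refine contDiff_const.mul (((Complex.contDiff_exp.comp (hx1.mul contDiff_const)).pow _).mul
    ((((Complex.contDiff_exp.comp (hx2.mul contDiff_const)).pow _).mul
      ((hx1.pow _).mul ((hx2.pow _).mul contDiff_const)))))

/-- local Lipschitz bound of `Frel₂` at a point `p₀ ∈ ℝ²` -/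
theorem exists_lipschitz_Frel₂ (θ : Fin n → ℂ) (y₀ : ℂ) (p₀ : ℝ × ℝ) :
    ∃ Kl δ₁ : ℝ, 0 ≤ Kl ∧ 0 < δ₁ ∧
      ∀ x : ℝ × ℝ, dist x p₀ < δ₁ → ‖Frel₂ P θ y₀ x - Frel₂ P θ y₀ p₀‖ ≤ Kl * dist x p₀ := by
  obtain ⟨K, t, ht, hK⟩ := ((contDiff_Frel₂ P θ y₀).contDiffAt (x := p₀)).exists_lipschitzOnWith
  obtain ⟨δ₁, hδ₁, hball⟩ := Metric.mem_nhds_iff.mp ht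
  refine ⟨K, δ₁, K.2, hδ₁, fun x hx => ?_⟩
  have hxt : x ∈ t := hball (by rw [Metric.mem_ball]; exact hx)
  have hρt : p₀ ∈ t := hball (Metric.mem_ball_self hδ₁)
  have := (lipschitzOnWith_iff_dist_le_mul.mp hK) x hxt p₀ hρt
  rwa [dist_eq_norm] at this

/-- **The eigenvalue is `q^J F(a/q, b/q)`**: `Σ_k C_k(θ) w^{a k₁ + b k₂} = q^J · F(a/q, b/q)` when `w^a = e^{(a/q) y₀}`
and `w^b = e^{(b/q) y₀}`. -/
theorem eigen_eq_Frel₂ (θ : Fin n → ℂ) (y₀ : ℂ) {K₁ K₂ : ℕ} (hK₁ : ∀ s ∈ P.support, s 0 ≤ K₁)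
    (hK₂ : ∀ s ∈ P.support, s 1 ≤ K₂) (hJ : ∀ s ∈ P.support, s 2 + s 3 ≤ J) (hq : 0 < q) (w : ℂ)
    (hwa : w ^ a = cexp (((((a : ℝ) / q : ℝ)) : ℂ) * y₀))
    (hwb : w ^ b = cexp (((((b : ℝ) / q : ℝ)) : ℂ) * y₀)) :
    ∑ k ∈ Finset.range (K₁ + 1) ×ˢ Finset.range (K₂ + 1), aeval θ (Cf₂ P a b q J k) * w ^ (a * k.1 + b * k.2) =
      (q : ℂ) ^ J * Frel₂ P θ y₀ ((a : ℝ) / q, (b : ℝ) / q) := by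
  classical
  have hqC : (q : ℂ) ≠ 0 := by exact_mod_cast hq.ne'
  simp_rw [aeval_Cf₂, Finset.sum_mul]
  have step : ∀ k ∈ Finset.range (K₁ + 1) ×ˢ Finset.range (K₂ + 1),
      ∑ s ∈ P.support with ((s 0, s 1) : ℕ × ℕ) = k,
        (((P.coeff s * (a : ℤ) ^ (s 2) * (b : ℤ) ^ (s 3) * (q : ℤ) ^ (J - s 2 - s 3) : ℤ)) : ℂ) *
          (∏ j, θ j ^ (s j.succ.succ.succ.succ)) * w ^ (a * k.1 + b * k.2) =
      ∑ s ∈ P.support with ((s 0, s 1) : ℕ × ℕ) = k,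
        (q : ℂ) ^ J * (((P.coeff s : ℤ) : ℂ) *
          (cexp (((((a : ℝ) / q : ℝ)) : ℂ) * y₀) ^ (s 0) * (cexp (((((b : ℝ) / q : ℝ)) : ℂ) * y₀) ^ (s 1) *
            ((((((a : ℝ) / q : ℝ)) : ℂ)) ^ (s 2) * ((((((b : ℝ) / q : ℝ)) : ℂ)) ^ (s 3) *
              ∏ j, θ j ^ (s j.succ.succ.succ.succ)))))) := by
    intro k _
    refine Finset.sum_congr rfl fun s hs => ?_
    have hsk : ((s 0, s 1) : ℕ × ℕ) = k := (Finset.mem_filter.1 hs).2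
    have hs23 : s 2 + s 3 ≤ J := hJ s (Finset.mem_filter.1 hs).1
    have hk1 : k.1 = s 0 := by rw [← hsk]
    have hk2 : k.2 = s 1 := by rw [← hsk]
    rw [hk1, hk2, pow_add, pow_mul, pow_mul, hwa, hwb]
    obtain ⟨t, ht⟩ : ∃ t, t = J - s 2 - s 3 := ⟨_, rfl⟩
    rw [← ht]
    have hJt : J = t + s 2 + s 3 := by omega
    have hpq : ((a : ℂ)) ^ (s 2) * ((b : ℂ)) ^ (s 3) * (q : ℂ) ^ t =
        (q : ℂ) ^ J * ((((((a : ℝ) / q : ℝ)) : ℂ)) ^ (s 2) * (((((b : ℝ) / q : ℝ)) : ℂ)) ^ (s 3)) := by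
      rw [hJt, pow_add, pow_add]
      push_cast
      rw [div_pow, div_pow]
      field_simp
    simp only [Int.cast_mul, Int.cast_pow, Int.cast_natCast]
    linear_combination (((P.coeff s : ℤ) : ℂ) * (∏ j, θ j ^ (s j.succ.succ.succ.succ)) *
      cexp (((((a : ℝ) / q : ℝ)) : ℂ) * y₀) ^ (s 0) * cexp (((((b : ℝ) / q : ℝ)) : ℂ) * y₀) ^ (s 1)) * hpq
  rw [Finset.sum_congr rfl step,
    Finset.sum_fiberwise_of_maps_to (fun s hs => Finset.mem_product.2
      ⟨Finset.mem_range.2 (Nat.lt_succ_of_le (hK₁ s hs)), Finset.mem_range.2 (Nat.lt_succ_of_le (hK₂ s hs))⟩),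
    ← Finset.mul_sum]
  rfl

end KernelData

/-! ## §C  THE CLASS `JU`; Kronecker collision; two-dimensional non-vanishing; the typed obstruction; Baire -/

section ClassJU
open MvPolynomial
open Summit.Schanuel.Schanuel.Theorems.RootDecomp1BRadicalDescent (UltraLiouville DExpMeasure)
open Summit.Schanuel.Schanuel.Theorems.RootDecomp1KHyper (mvlen mvlen_nonneg one_le_mvlen mvaeval_int_map)

/-- [class] definition (membership predicate with parameters, NOT a fact; census convention, VERDICT L2210; same status as the tree's `RootDecomp1BRadicalDescent.UltraLiouville`). **Jointly ultra-Liouville pairs** (COMMON denominators `q`, integer numerators): for every `m` there are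
`q ≥ m` and `a, b ∈ ℤ` with `|ρ − a/q| < exp(−exp(q^m))` and `|σ − b/q| < exp(−exp(q^m))`. -/
def UltraLiouville₂ (ρ σ : ℝ) : Prop :=
  ∀ m : ℕ, ∃ (q : ℕ) (a b : ℤ), m ≤ q ∧ |ρ - (a : ℝ) / q| < Real.exp (-Real.exp ((q : ℝ) ^ m)) ∧
    |σ - (b : ℝ) / q| < Real.exp (-Real.exp ((q : ℝ) ^ m))

/-- [class] definition (membership predicate with parameters, NOT a fact; census convention, VERDICT L2210): **the class `JU`** — positive, jointly ultra-Liouville, algebraically independent pairs; non-empty and dense in the open positive quadrant by `dense_setOf_JU` (Baire, hypothesis-free, part 04); `(1, ρ, ρ²) ∉ JU` by `not_JU_sq`. -/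
def JU (ρ σ : ℝ) : Prop :=
  0 < ρ ∧ 0 < σ ∧ UltraLiouville₂ ρ σ ∧ AlgebraicIndependent ℚ ![(ρ : ℂ), (σ : ℂ)]

variable {ρ σ : ℝ}

/-- `UltraLiouville₂` is symmetric. -/
theorem UltraLiouville₂.symm (h : UltraLiouville₂ ρ σ) : UltraLiouville₂ σ ρ := fun m => by
  obtain ⟨q, a, b, hq, ha, hb⟩ := h m
  exact ⟨q, b, a, hq, hb, ha⟩

/-- approximations of order `m` with common denominator above any threshold `Q` (and `q ≥ 1`). -/
theorem UltraLiouville₂.exists_ge (h : UltraLiouville₂ ρ σ) (m Q : ℕ) :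
    ∃ (q : ℕ) (a b : ℤ), Q ≤ q ∧ 1 ≤ q ∧ |ρ - (a : ℝ) / q| < Real.exp (-Real.exp ((q : ℝ) ^ m)) ∧
      |σ - (b : ℝ) / q| < Real.exp (-Real.exp ((q : ℝ) ^ m)) := by
  obtain ⟨q, a, b, hq, ha, hb⟩ := h (max (max m Q) 1)
  have hq1 : 1 ≤ q := (le_max_right _ _).trans hq
  have hmono : Real.exp (-Real.exp ((q : ℝ) ^ (max (max m Q) 1))) ≤ Real.exp (-Real.exp ((q : ℝ) ^ m)) := by
    rw [Real.exp_le_exp, neg_le_neg_iff, Real.exp_le_exp]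
    exact pow_le_pow_right₀ (by exact_mod_cast hq1) ((le_max_left _ _).trans (le_max_left _ _))
  exact ⟨q, a, b, (le_max_right _ _).trans ((le_max_left _ _).trans hq), hq1, ha.trans_le hmono,
    hb.trans_le hmono⟩

/-- `M ≤ q^M` for `1 ≤ q`, `M ≤ q`. -/
private theorem self_le_pow_of_le {q M : ℕ} (hq : 1 ≤ q) (hM : M ≤ q) : (M : ℝ) ≤ (q : ℝ) ^ M := by
  rcases Nat.eq_zero_or_pos M with hM0 | hM0
  · rw [hM0, pow_zero]; norm_num
  · calc (M : ℝ) ≤ q := by exact_mod_cast hM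
      _ = (q : ℝ) ^ 1 := (pow_one _).symm
      _ ≤ (q : ℝ) ^ M := pow_le_pow_right₀ (by exact_mod_cast hq) hM0

/-- The FIRST coordinate of a jointly ultra-Liouville pair, if irrational, is ultra-Liouville in the tree sense
(`RootDecomp1BRadicalDescent.UltraLiouville`: REDUCED denominators `≥ m`, `ρ ≠ r`) — so the storeys `(1, ρ)`,
`(1, σ)` below a `JU` cell are g30 cells BY NAME. (Irrationality is needed: `(0, 0)` is jointly ultra-Liouville.) -/
theorem UltraLiouville₂.left (h : UltraLiouville₂ ρ σ) (hρ : Irrational ρ) : UltraLiouville ρ := by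
  classical
  intro m
  -- (1) a positive lower bound for `|ρ − r|` over the rationals `r` with `den r ≤ m`
  have hsep : ∃ δ : ℝ, 0 < δ ∧ ∀ r : ℚ, r.den ≤ m → δ ≤ |ρ - r| := by
    have hpos : ∀ d : ℕ, 0 < d → 0 < |ρ * d - round (ρ * d)| / d := by
      intro d hd
      have hd' : (0 : ℝ) < d := by exact_mod_cast hd
      refine div_pos (abs_pos.2 (sub_ne_zero.2 fun heq => hρ ⟨(round (ρ * d) : ℚ) / d, ?_⟩)) hd'
      push_cast
      rw [← heq]; field_simp
    have hbound : ∀ r : ℚ, |ρ * r.den - round (ρ * r.den)| / r.den ≤ |ρ - r| := by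
      intro r
      have hd' : (0 : ℝ) < r.den := by exact_mod_cast r.pos
      rw [div_le_iff₀ hd']
      calc |ρ * r.den - round (ρ * r.den)| ≤ |ρ * r.den - r.num| := round_le _ _
        _ = |ρ - r| * r.den := by
            rw [← abs_of_pos hd', ← abs_mul, abs_of_pos hd']
            congr 1
            rw [sub_mul, Rat.cast_def, div_mul_cancel₀ _ hd'.ne']
    rcases (Finset.Icc 1 m).eq_empty_or_nonempty with he | hne
    · refine ⟨1, one_pos, fun r hr => ?_⟩
      exfalso
      have : r.den ∈ Finset.Icc 1 m := Finset.mem_Icc.2 ⟨r.pos, hr⟩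
      rw [he] at this
      simp at this
    · obtain ⟨d₀, hd₀, hmin⟩ := Finset.exists_min_image (Finset.Icc 1 m)
        (fun d : ℕ => |ρ * d - round (ρ * d)| / d) hne
      refine ⟨_, hpos d₀ (Finset.mem_Icc.1 hd₀).1, fun r hr => ?_⟩
      exact (hmin _ (Finset.mem_Icc.2 ⟨r.pos, hr⟩)).trans (hbound r)
  obtain ⟨δ, hδ, hsepδ⟩ := hsep
  -- (2) an approximation of order `M = max m N`, `N > −log δ`, common denominator `q ≥ M`
  obtain ⟨N, hN⟩ := exists_nat_gt (-Real.log δ)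
  obtain ⟨q, a, b, hqM, hq1, ha, -⟩ := h.exists_ge (max m N) (max m N)
  have hq1r : (1 : ℝ) ≤ q := by exact_mod_cast hq1
  have hq0r : (0 : ℝ) < q := by positivity
  set r : ℚ := (a : ℚ) / q with hr
  have hrR : (r : ℝ) = (a : ℝ) / q := by rw [hr]; push_cast; rfl
  have hden : r.den ≤ q := by
    have h1 : ((r.den : ℤ)) ∣ (q : ℤ) := by
      have h := Rat.den_dvd a (q : ℤ)
      rw [Rat.divInt_eq_div, Int.cast_natCast] at h
      rw [hr]; exact h
    exact_mod_cast Int.le_of_dvd (by exact_mod_cast hq1) h1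
  have hsmall : Real.exp (-Real.exp ((q : ℝ) ^ (max m N))) < δ := by
    have h1 : ((max m N : ℕ) : ℝ) ≤ (q : ℝ) ^ (max m N) := self_le_pow_of_le hq1 hqM
    have h2 : (q : ℝ) ^ (max m N) + 1 ≤ Real.exp ((q : ℝ) ^ (max m N)) := Real.add_one_le_exp _
    have h3 : (N : ℝ) ≤ ((max m N : ℕ) : ℝ) := by exact_mod_cast le_max_right m N
    rw [← Real.exp_log hδ, Real.exp_lt_exp]
    linarith
  have hρr : |ρ - r| < Real.exp (-Real.exp ((q : ℝ) ^ (max m N))) := by rw [hrR]; exact ha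
  refine ⟨r, ?_, hρ.ne_rat r, ?_⟩
  · by_contra hlt
    push Not at hlt
    have := hsepδ r hlt.le
    linarith [hρr.trans hsmall]
  · refine hρr.trans_le ?_
    rw [Real.exp_le_exp, neg_le_neg_iff, Real.exp_le_exp]
    calc ((r.den : ℝ)) ^ m ≤ (q : ℝ) ^ m := pow_le_pow_left₀ (by positivity) (by exact_mod_cast hden) m
      _ ≤ (q : ℝ) ^ (max m N) := pow_le_pow_right₀ hq1r (le_max_left _ _)

/-- … and the SECOND coordinate. -/
theorem UltraLiouville₂.right (h : UltraLiouville₂ ρ σ) (hσ : Irrational σ) : UltraLiouville σ :=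
  h.symm.left hσ

/-- A nonzero INTEGER polynomial does not vanish at an algebraically independent tuple. -/
theorem aeval_ne_zero_of_algebraicIndependent {k : ℕ} {v : Fin k → ℂ} (hai : AlgebraicIndependent ℚ v)
    (μ : MvPolynomial (Fin k) ℤ) (hμ : μ ≠ 0) : aeval v μ ≠ 0 := by
  intro h
  have h1 : aeval v (map (Int.castRingHom ℚ) μ) = 0 := by rw [mvaeval_int_map]; exact h
  have h2 := algebraicIndependent_iff.1 hai _ h1
  exact hμ (map_injective _ Int.cast_injective (by rw [h2, map_zero]))

/-- Algebraic independence of `(ρ, σ)` makes each coordinate transcendental, hence irrational. -/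
theorem irrational_left_of_algebraicIndependent (hai : AlgebraicIndependent ℚ ![(ρ : ℂ), (σ : ℂ)]) :
    Irrational ρ := by
  refine Transcendental.irrational fun halg => ?_
  have h1 : IsAlgebraic ℚ ((ρ : ℂ)) := by
    have := halg.algebraMap (A := ℂ)
    simpa using this
  exact hai.transcendental 0 (by simpa using h1)

/-- … and the second coordinate. -/
theorem irrational_right_of_algebraicIndependent (hai : AlgebraicIndependent ℚ ![(ρ : ℂ), (σ : ℂ)]) :
    Irrational σ := by
  refine Transcendental.irrational fun halg => ?_
  have h1 : IsAlgebraic ℚ ((σ : ℂ)) := by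
    have := halg.algebraMap (A := ℂ)
    simpa using this
  exact hai.transcendental 1 (by simpa using h1)

end ClassJU

end Summit.Schanuel.Schanuel.Theorems.RootDecomp1BTwoStorey

end
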